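import Literature.NumberTheory.EllipticCurves.CastellaHsuKunduLeeLiu2025.SignedBipartiteEulerSystem
import HarnessLib

/-!
# Line `admdef`: Howard's non-vanishing criterion [NV] (`B.HasUnitLambda N`) READ AT THE BOTTOM LAYER through the two explicit
# reciprocity laws of the typed signed bipartite system — kernel (crux `AnticyclotomicEisensteinDivisibility`,
# stmt-BirchSwinnertonDyer-20727; LEAD seat bsd-line-sbc-p1 gen 19, `--supports stmt-BirchSwinnertonDyer-20727`)

WHY THIS FILE.  On cell β the line `admdef` (skeleton of record v12) reaches C⁺⁺_NS through Castella–Hsu–Kundu–Lee–Liu 2025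
Thm. 7.5 = Howard 2006 Thm. 3.2.3, whose EQUALITY clause needs [NV] = `B.HasUnitLambda N`: «for some `j > 0` there is
`m ∈ 𝒩_j^def` with `λ±_j(m)` non-zero in `Λ/𝔪 ≃ 𝔽_p`».  The skeleton obtains [NV] from the research stub (Anch±) and the
BRIDGE stub (print construction `λ ↔ Θ`).  THIS FILE records, in kernel and in the typed currency of
`Literature/…/CastellaHsuKunduLeeLiu2025/SignedBipartiteEulerSystem.lean` ONLY (no Brandt modules, no theta elements, no
named fact), what the two typed reciprocity laws of `IsSignedBipartiteSystem` already say about [NV] at the BOTTOM layer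
`n = 0` of the anticyclotomic tower (i.e. over `K`, at the trivial character):

* (second law, `j = 1`) if for some indefinite vertex `m`, some `1`-admissible `q ∤ m` with `mq ∈ 𝒩_1^def`, some prime
  `𝔓` of `K̄` over the place `v ∋ q` of `K` and some Frobenius `φ ∈ D_𝔓 ∩ Gal(K̄/K_∞)`, the UNRAMIFIED COORDINATE of the
  class `κ_1(m)` at `φ` is non-zero AT THE BOTTOM LAYER — `res_{⟨φ⟩}(conj_{γ^a}⁻¹ κ_1(m)_0) ≠ 0` in `H¹(⟨φ⟩, E[p])` — then
  `λ_1(mq)(0) ∈ ℤ_pˣ`, hence `B.HasUnitLambda N` (`isUnit_constantCoeff_lam_of_unrLoc_ne_zero`, `hasUnitLambda_of_unrLoc_ne_zero`);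
* (first law, `j = 1`) the same with the INERTIAL coordinate of `κ_1(nq)` at `𝔓 ∣ q` giving `λ_1(n)(0) ∈ ℤ_pˣ`
  (`isUnit_constantCoeff_lam_of_ordLoc_ne_zero`);
* at the ROOT `m = 1` with the limit base class `z` of the system (`B.IsLimitBaseClass z`, CHKLL25 (7.2)): if the bottom
  class `z_{0,1} ∈ H¹(K, E[p])` has non-zero restriction to `⟨φ⟩` for a Frobenius `φ` at a prime over a `1`-admissible `q`,
  then [NV] (`hasUnitLambda_of_limitBaseClass_res_ne_zero`).  For the `+` system at Castella–Wan's class, `z_{0,1}` is the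
  Kummer class of the norm point `N_{K[p]/K} x_p = (a_p − σ_𝔭 − σ_𝔭̄) y_K = −2 y_K` (`a_p = 0`): this is Howard's
  «primitive root» case (the Heegner point `y_K` not divisible by `p` in `E(K)`, localised by Čebotarev at an admissible
  prime), where Kolyvagin's original argument already gives the `p`-part of BSD in rank one — so the file also DOCUMENTS,
  by contraposition, why the line needs an anchor at a deeper definite vertex exactly when `δ(y_K) ≡ 0 (mod p)`:
  then every `λ_1(q)(0)`, `q` admissible, is a NON-unit.

The mechanism is one line of Howard/BCK21 («core vertices», [Howard2006] Lem. 2.3.3–2.3.4 / [BCK21] Lem. 7.3) in its most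
elementary instance: a reciprocity law `Λ·x = λ·M` (`SpanEqSmul`) gives `x = λ·y` for a coinduced family `y`; at layer
`n = 0` the group `Γ/Γ^{p⁰}` is trivial, `γ − 1` acts as `0` (`coPsi_layer_zero_apply`), so the truncated `Λ`-action is
multiplication by the constant coefficient through `ℤ_p → ℤ/p^j` (`coTsmul_layer_zero_apply`); with `j = 1` a non-unit
constant coefficient acts as `0` (`toZModPow_one_eq_zero_of_not_isUnit`).  HONEST FRAMING: a kernel reading of the typed
laws; nothing about Heegner points, the BRIDGE, (Anch±) or the crux is asserted; [NV] is NOT proved here (its hypothesis —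
a non-zero bottom localisation — is exactly what the anchor must supply when the root class vanishes mod `p`).  BSD is not
proved by this file.

References: [cite: CastellaEtAl2025, Thm. 7.4 (two reciprocity laws), (7.2), Thm. 7.5 (arXiv:2308.10474v2 p0030 L29–L62, p0031 L1–L30)]
[cite: Howard2006, Thm. 3.2.3 (c), Lem. 3.1.2, §3.2 (15)–(16)] [cite: BurungaleCastellaKim2021, arXiv:1908.09512 Lem. 7.3 and Prop. 7.4 (journal Lem. 3.6)].
-/

-- D-0017: single-problem summit, the namespace repeats the problem name by design.
set_option linter.dupNamespace false
set_option autoImplicit false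

noncomputable section

open scoped Classical
open NumberField IsDedekindDomain Field
open Literature.NumberTheory.EllipticCurves Literature.NumberTheory.GaloisRepresentations
open Literature.NumberTheory.EllipticCurves.IwasawaDual
open Literature.NumberTheory.EllipticCurves.BertoliniDarmon2005
open Literature.NumberTheory.EllipticCurves.CastellaHsuKunduLeeLiu2025
open WeierstrassCurve (geomTorsion)

namespace Summit.BirchSwinnertonDyer.BirchSwinnertonDyer.Theorems.SignedBaseChangeAcDivAdmdefUnitLambdaOfLoc

universe u

/-! ## §1 The truncated `Λ`-action at the bottom layer `n = 0` -/

section LayerZero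

variable (p : ℕ) [Fact p.Prime] {U : Type*} [AddCommGroup U]

omit [Fact p.Prime] in
/-- At layer `n = 0` the group `Γ/Γ^{p⁰} = ℤ/1` is a point, so `γ − 1` (the operator `coPsi p 0`: translation minus identity
on `U`-valued functions on `ℤ/p⁰`) acts as ZERO. [cite: Howard2006, Lem. 3.1.2 (the coinduced module at the bottom layer)] -/
theorem coPsi_layer_zero_apply (u : ZMod (p ^ 0) → U) : coPsi p 0 u = 0 := by
  haveI : Subsingleton (ZMod (p ^ 0)) := ZMod.subsingleton_iff.2 (pow_zero p)
  funext a
  rw [coPsi_apply, Subsingleton.elim (a - 1) a, sub_self, Pi.zero_apply]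

omit [Fact p.Prime] in
/-- Hence every positive power of `γ − 1` acts as zero at layer `0`. [cite: Howard2006, Lem. 3.1.2] -/
theorem coPsi_layer_zero_pow_apply {i : ℕ} (hi : i ≠ 0) (u : ZMod (p ^ 0) → U) : (coPsi p 0 ^ i) u = 0 := by
  obtain ⟨k, rfl⟩ := Nat.exists_eq_succ_of_ne_zero hi
  rw [AddMonoid.End.coe_pow, Function.iterate_succ_apply, coPsi_layer_zero_apply,
    Function.iterate_fixed (map_zero (coPsi p 0 : AddMonoid.End (ZMod (p ^ 0) → U))) k]

/-- **At the bottom layer the truncated `Λ`-action is multiplication by the constant coefficient through `ℤ_p → ℤ/p^j`**: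
`(f · u)_0 = (f(0) mod p^j) · u_0` — all higher powers of `γ − 1` vanish on `U[Γ/Γ^{p⁰}] = U`.
[cite: Howard2006, Lem. 3.1.2] [cite: Lang1990, Ch. 5 §1 Thm. 1.1] -/
theorem coTsmul_layer_zero (j : ℕ) (f : IwasawaAlgebra p) (u : Π n : ℕ, ZMod (p ^ n) → U) :
    coTsmul p j f u 0 = (PadicInt.toZModPow j (PowerSeries.constantCoeff f)).val • u 0 := by
  rcases Nat.eq_zero_or_pos j with rfl | hj
  · haveI : Subsingleton (ZMod (p ^ 0)) := ZMod.subsingleton_iff.2 (pow_zero p)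
    rw [Subsingleton.elim (PadicInt.toZModPow 0 (PowerSeries.constantCoeff f)) 0, ZMod.val_zero, zero_smul,
      coTsmul_apply, evalT_def, zero_mul, Finset.sum_range_zero]
  · rw [coTsmul_apply, evalT_def]
    have h0 : 0 ∈ Finset.range (j * p ^ 0) := Finset.mem_range.mpr (by rw [pow_zero, mul_one]; exact hj)
    rw [Finset.sum_eq_single_of_mem 0 h0 fun i _ hi ↦ by
      rw [AddMonoidHom.id_apply, coPsi_layer_zero_pow_apply p hi, zpT_zero_right]]
    rw [pow_zero (coPsi p 0), AddMonoid.End.one_apply, AddMonoidHom.id_apply, zpT_def,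
      PowerSeries.coeff_zero_eq_constantCoeff_apply]

/-- Componentwise form of `coTsmul_layer_zero`. [cite: Howard2006, Lem. 3.1.2] -/
theorem coTsmul_layer_zero_apply (j : ℕ) (f : IwasawaAlgebra p) (u : Π n : ℕ, ZMod (p ^ n) → U)
    (a : ZMod (p ^ 0)) :
    coTsmul p j f u 0 a = (PadicInt.toZModPow j (PowerSeries.constantCoeff f)).val • u 0 a := by
  rw [coTsmul_layer_zero, Pi.smul_apply]

/-- A non-unit of `ℤ_p` reduces to `0` in `ℤ/p`. [folklore] -/
theorem toZModPow_one_eq_zero_of_not_isUnit {c : ℤ_[p]} (hc : ¬ IsUnit c) : PadicInt.toZModPow 1 c = 0 := by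
  have hdvd : (p : ℤ_[p]) ∣ c := (PadicInt.norm_lt_one_iff_dvd _).mp (PadicInt.mem_nonunits.mp (mem_nonunits_iff.mpr hc))
  rw [← RingHom.mem_ker, PadicInt.ker_toZModPow, pow_one]
  exact Ideal.mem_span_singleton.mpr hdvd

/-- **The elementary core of the criterion**: if a raw family `x` lies on the line `λ · M` (`x = λ · y`, the first clause of
`SpanEqSmul p 1 λ x M`) at torsion level `j = 1` and `λ(0)` is NOT a unit of `ℤ_p`, then the bottom component of `x`
vanishes identically: `x_0 = 0`. [cite: Howard2006, Lem. 3.1.2 and §3.2 (15)] -/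
theorem layer_zero_eq_zero_of_spanEqSmul_of_not_isUnit {lam : IwasawaAlgebra p} {x : Π n : ℕ, ZMod (p ^ n) → U}
    {M : (Π n : ℕ, ZMod (p ^ n) → U) → Prop} (h : SpanEqSmul p 1 lam x M)
    (hlam : ¬ IsUnit (PowerSeries.constantCoeff lam)) (a : ZMod (p ^ 0)) : x 0 a = 0 := by
  obtain ⟨y, -, rfl⟩ := h.1
  rw [coTsmul_layer_zero_apply, toZModPow_one_eq_zero_of_not_isUnit p hlam, ZMod.val_zero, zero_smul]

/-- Contrapositive packaging: a non-zero bottom component on a `j = 1` reciprocity line forces `λ(0) ∈ ℤ_pˣ`.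
[cite: Howard2006, Thm. 3.2.3 (c) and §3.2 (15)] -/
theorem isUnit_constantCoeff_of_spanEqSmul_of_layer_zero_ne_zero {lam : IwasawaAlgebra p}
    {x : Π n : ℕ, ZMod (p ^ n) → U} {M : (Π n : ℕ, ZMod (p ^ n) → U) → Prop} (h : SpanEqSmul p 1 lam x M)
    {a : ZMod (p ^ 0)} (hx : x 0 a ≠ 0) : IsUnit (PowerSeries.constantCoeff lam) := by
  by_contra hlam
  exact hx (layer_zero_eq_zero_of_spanEqSmul_of_not_isUnit p h hlam a)

end LayerZero

/-! ## §2 [NV] from a non-zero bottom localisation, through the two typed reciprocity laws -/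

section Laws

variable {K : Type} [Field K] [NumberField K] {W : WeierstrassCurve ℚ} [W.IsGloballyMinimal] {p : ℕ} [Fact p.Prime]
  {κ : ZpExtension K p} {γ : absoluteGaloisGroup K} {N : ℕ} {ε : ℤˣ} {B : SignedBipartiteSystem W K p κ}

/-- **Second law at the bottom layer.**  Let `B` be a signed bipartite system of sign `ε` at level `N` (`IsSignedBipartiteSystem`,
CHKLL25 Thm. 7.4 as typed).  If `m q ∈ 𝒩_1^def` with `q` a `1`-admissible prime not dividing `m`, and at some prime `𝔓` of `K̄` over
the place `v ∋ q` of `K` and some Frobenius `φ ∈ D_𝔓 ∩ Gal(K̄/K_∞)` the unramified coordinate of `κ_1(m)` is non-zero at the bottom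
layer (`unrLoc … (B.kappa 1 m) 0 a ≠ 0`, i.e. `res_{⟨φ⟩}(conj_{γ^a}⁻¹ κ_1(m)_0) ≠ 0` in `H¹(⟨φ⟩, E[p])`), then `λ_1(mq)(0)` is a unit of
`ℤ_p`: the second reciprocity law «`loc_q(κ_1(m)) = λ_1(mq)` under `H¹_unr(K_q, T_1) ≃ Λ/pΛ`» read modulo `𝔪 = (p, T)`.
[cite: CastellaEtAl2025, Thm. 7.4, second law (arXiv:2308.10474v2 p0030 L50–L52)] [cite: Howard2006, §3.2 (15) and Thm. 3.2.3 (c)] -/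
theorem isUnit_constantCoeff_lam_of_unrLoc_ne_zero (hB : IsSignedBipartiteSystem W K p κ γ N ε B) {m q : ℕ}
    (hmq : m * q ∈ defProducts N K (fun ℓ ↦ W.frobeniusTrace ℓ) p 1)
    (hq : IsAdmissiblePrime N K (fun ℓ ↦ W.frobeniusTrace ℓ) p 1 q) (hqm : ¬ q ∣ m)
    {v : HeightOneSpectrum (𝓞 K)} (hv : ((q : ℕ) : 𝓞 K) ∈ v.asIdeal) {𝔓 : Ideal (absIntegers (𝓞 K) K)}
    (h𝔓 : 𝔓 ∈ v.primesAbove) {φ : absoluteGaloisGroup K} (hφ : φ ∈ κ.kerSubgroup)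
    (hφD : φ ∈ 𝔓.decompositionSubgroup (absoluteGaloisGroup K)) (hφF : IsArithFrobAt (𝓞 K) φ 𝔓) {a : ZMod (p ^ 0)}
    (hne : unrLoc (W.baseChange K) p κ γ 1 hφ (B.kappa 1 m) 0 a ≠ 0) :
    IsUnit (PowerSeries.constantCoeff (B.lam 1 (m * q))) :=
  isUnit_constantCoeff_of_spanEqSmul_of_layer_zero_ne_zero p
    (hB.second_law 1 m q one_pos hmq hq hqm v hv 𝔓 h𝔓 φ hφ hφD hφF) hne

/-- **[NV] from the second law at the bottom layer**: under the hypotheses of `isUnit_constantCoeff_lam_of_unrLoc_ne_zero`, the system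
satisfies Howard's criterion `B.HasUnitLambda N` (witness `j = 1`, vertex `mq ∈ 𝒩_1^def`).
[cite: CastellaEtAl2025, Thm. 7.5 (arXiv:2308.10474v2 p0031 L17–L20)] [cite: Howard2006, Thm. 3.2.3 (c)] -/
theorem hasUnitLambda_of_unrLoc_ne_zero (hB : IsSignedBipartiteSystem W K p κ γ N ε B) {m q : ℕ}
    (hmq : m * q ∈ defProducts N K (fun ℓ ↦ W.frobeniusTrace ℓ) p 1)
    (hq : IsAdmissiblePrime N K (fun ℓ ↦ W.frobeniusTrace ℓ) p 1 q) (hqm : ¬ q ∣ m)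
    {v : HeightOneSpectrum (𝓞 K)} (hv : ((q : ℕ) : 𝓞 K) ∈ v.asIdeal) {𝔓 : Ideal (absIntegers (𝓞 K) K)}
    (h𝔓 : 𝔓 ∈ v.primesAbove) {φ : absoluteGaloisGroup K} (hφ : φ ∈ κ.kerSubgroup)
    (hφD : φ ∈ 𝔓.decompositionSubgroup (absoluteGaloisGroup K)) (hφF : IsArithFrobAt (𝓞 K) φ 𝔓) {a : ZMod (p ^ 0)}
    (hne : unrLoc (W.baseChange K) p κ γ 1 hφ (B.kappa 1 m) 0 a ≠ 0) :
    B.HasUnitLambda N :=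
  ⟨1, one_pos, m * q, hmq, isUnit_constantCoeff_lam_of_unrLoc_ne_zero hB hmq hq hqm hv h𝔓 hφ hφD hφF hne⟩

/-- **First law at the bottom layer.**  If `n q ∈ 𝒩_1^ind` with `q` a `1`-admissible prime not dividing `n`, and at some prime `𝔓`
of `K̄` over the place `v ∋ q` the inertial (ordinary) coordinate of `κ_1(nq)` is non-zero at the bottom layer
(`ordLoc … (B.kappa 1 (n*q)) 0 a ≠ 0`), then `λ_1(n)(0) ∈ ℤ_pˣ`: the first reciprocity law «`loc_q(κ_1(nq)) = λ_1(n)` under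
`H¹_ord(K_q, T_1) ≃ Λ/pΛ`» read modulo `𝔪`.  (For `n ∈ 𝒩_1^def` this is again Howard's criterion, `hasUnitLambda_of_ordLoc_ne_zero`.)
[cite: CastellaEtAl2025, Thm. 7.4, first law (arXiv:2308.10474v2 p0030 L46–L49)] [cite: Howard2006, §3.2 (15) and Thm. 3.2.3 (c)] -/
theorem isUnit_constantCoeff_lam_of_ordLoc_ne_zero (hB : IsSignedBipartiteSystem W K p κ γ N ε B) {n q : ℕ}
    (hnq : n * q ∈ indefProducts N K (fun ℓ ↦ W.frobeniusTrace ℓ) p 1)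
    (hq : IsAdmissiblePrime N K (fun ℓ ↦ W.frobeniusTrace ℓ) p 1 q) (hqn : ¬ q ∣ n)
    {v : HeightOneSpectrum (𝓞 K)} (hv : ((q : ℕ) : 𝓞 K) ∈ v.asIdeal) {𝔓 : Ideal (absIntegers (𝓞 K) K)}
    (h𝔓 : 𝔓 ∈ v.primesAbove) {a : ZMod (p ^ 0)}
    (hne : ordLoc (W.baseChange K) p κ γ 1 𝔓 (B.kappa 1 (n * q)) 0 a ≠ 0) :
    IsUnit (PowerSeries.constantCoeff (B.lam 1 n)) :=
  isUnit_constantCoeff_of_spanEqSmul_of_layer_zero_ne_zero p (hB.first_law 1 n q one_pos hnq hq hqn v hv 𝔓 h𝔓) hne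

/-- **[NV] from the first law at the bottom layer** (for a definite `n`). [cite: CastellaEtAl2025, Thm. 7.5 (arXiv:2308.10474v2 p0031 L17–L20)]
[cite: Howard2006, Thm. 3.2.3 (c)] -/
theorem hasUnitLambda_of_ordLoc_ne_zero (hB : IsSignedBipartiteSystem W K p κ γ N ε B) {n q : ℕ}
    (hn : n ∈ defProducts N K (fun ℓ ↦ W.frobeniusTrace ℓ) p 1)
    (hnq : n * q ∈ indefProducts N K (fun ℓ ↦ W.frobeniusTrace ℓ) p 1)
    (hq : IsAdmissiblePrime N K (fun ℓ ↦ W.frobeniusTrace ℓ) p 1 q) (hqn : ¬ q ∣ n)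
    {v : HeightOneSpectrum (𝓞 K)} (hv : ((q : ℕ) : 𝓞 K) ∈ v.asIdeal) {𝔓 : Ideal (absIntegers (𝓞 K) K)}
    (h𝔓 : 𝔓 ∈ v.primesAbove) {a : ZMod (p ^ 0)}
    (hne : ordLoc (W.baseChange K) p κ γ 1 𝔓 (B.kappa 1 (n * q)) 0 a ≠ 0) :
    B.HasUnitLambda N :=
  ⟨1, one_pos, n, hn, isUnit_constantCoeff_lam_of_ordLoc_ne_zero hB hnq hq hqn hv h𝔓 hne⟩

end Laws

/-! ## §3 The root `m = 1`: a single admissible prime, and the limit base class -/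

section Root

variable {K : Type} [Field K] [NumberField K] {W : WeierstrassCurve ℚ} [W.IsGloballyMinimal] {p : ℕ} [Fact p.Prime]
  {κ : ZpExtension K p} {γ : absoluteGaloisGroup K} {N : ℕ} {ε : ℤˣ} {B : SignedBipartiteSystem W K p κ}

omit [NumberField K] [Fact p.Prime] in
/-- A single `j`-admissible prime is a definite vertex: `q ∈ 𝒩_j^def` (square-free, one prime factor — odd — all of whose prime
divisors are admissible).  With `N⁻ = 1` these are the vertices adjacent to the root. [cite: CastellaEtAl2025, §7.2 (arXiv:2308.10474v2 p0030 L1–L6)]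
[cite: Howard2006, Def. 3.2.1] -/
theorem mem_defProducts_of_isAdmissiblePrime {a : ℕ → ℤ} {j q : ℕ} (hq : IsAdmissiblePrime N K a p j q) :
    q ∈ defProducts N K a p j := by
  have hqp : q.Prime := hq.prime
  refine ⟨⟨hqp.squarefree, fun q' hq' hq'q ↦ ?_⟩, ?_⟩
  · rwa [(Nat.prime_dvd_prime_iff_eq hq' hqp).mp hq'q]
  · rw [hqp.primeFactors, Finset.card_singleton]
    exact odd_one

omit [W.IsGloballyMinimal] in
/-- The unramified coordinate at `a = 0` is plain restriction: `unrLoc … x n 0 = res_{⟨φ⟩}(x_n)` (conjugation by `γ⁰ = 1` is the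
identity on `H¹`). [cite: Howard2006, Lem. 3.1.2] -/
theorem unrLoc_apply_zero {j n : ℕ} {φ : absoluteGaloisGroup K} (hφ : φ ∈ κ.kerSubgroup)
    (x : Π n : ℕ, (W.baseChange K).torsionH1Over ((p : ℤ) ^ j) (κ.layerSubgroup n)) :
    unrLoc (W.baseChange K) p κ γ j hφ x n 0 = resOfLe (geomTorsion (W.baseChange K) ((p : ℤ) ^ j))
      ((Subgroup.zpowers_le.mpr hφ).trans (κ.kerSubgroup_le_layerSubgroup n)) (x n) := by
  rw [unrLoc_apply, ZMod.val_zero, pow_zero, inv_one, conjH1_one_holds, AddMonoidHom.id_apply]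

/-- **[NV] at the root, second law with `m = 1`**: if the bottom class `κ_1(1)_0 ∈ H¹(K, E[p])` of the system has NON-ZERO
restriction to `⟨φ⟩` for a Frobenius `φ ∈ D_𝔓 ∩ Gal(K̄/K_∞)` at a prime `𝔓` over a `1`-admissible `q`, then `λ_1(q)(0) ∈ ℤ_pˣ`
and `B.HasUnitLambda N`.  [cite: CastellaEtAl2025, Thm. 7.4 second law, Thm. 7.5 (arXiv:2308.10474v2 p0030 L50–L52, p0031 L17–L20)]
[cite: Howard2006, Thm. 3.2.3 (c)] -/
theorem hasUnitLambda_of_root_res_ne_zero (hB : IsSignedBipartiteSystem W K p κ γ N ε B) {q : ℕ}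
    (hq : IsAdmissiblePrime N K (fun ℓ ↦ W.frobeniusTrace ℓ) p 1 q)
    {v : HeightOneSpectrum (𝓞 K)} (hv : ((q : ℕ) : 𝓞 K) ∈ v.asIdeal) {𝔓 : Ideal (absIntegers (𝓞 K) K)}
    (h𝔓 : 𝔓 ∈ v.primesAbove) {φ : absoluteGaloisGroup K} (hφ : φ ∈ κ.kerSubgroup)
    (hφD : φ ∈ 𝔓.decompositionSubgroup (absoluteGaloisGroup K)) (hφF : IsArithFrobAt (𝓞 K) φ 𝔓)
    (hne : resOfLe (geomTorsion (W.baseChange K) ((p : ℤ) ^ 1))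
      ((Subgroup.zpowers_le.mpr hφ).trans (κ.kerSubgroup_le_layerSubgroup 0)) (B.kappa 1 1 0) ≠ 0) :
    IsUnit (PowerSeries.constantCoeff (B.lam 1 q)) ∧ B.HasUnitLambda N := by
  have hmq : 1 * q ∈ defProducts N K (fun ℓ ↦ W.frobeniusTrace ℓ) p 1 := by
    rw [one_mul]; exact mem_defProducts_of_isAdmissiblePrime hq
  have hq1 : ¬ q ∣ 1 := fun h ↦ hq.prime.ne_one (Nat.eq_one_of_dvd_one h)
  have hne' : unrLoc (W.baseChange K) p κ γ 1 hφ (B.kappa 1 1) 0 0 ≠ 0 := by rwa [unrLoc_apply_zero]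
  have hunit := isUnit_constantCoeff_lam_of_unrLoc_ne_zero hB hmq hq hq1 hv h𝔓 hφ hφD hφF hne'
  rw [one_mul] at hunit hmq
  exact ⟨hunit, 1, one_pos, q, hmq, hunit⟩

/-- **[NV] from a non-zero bottom localisation of the LIMIT BASE CLASS** (CHKLL25 (7.2): `z_{n,j} = κ_j(1)_n`; for Castella–Wan's
`+` class the bottom component `z_{0,1}` is the Kummer class of `N_{K[p]/K} x_p = −2·y_K` when `a_p = 0`): if `res_{⟨φ⟩}(z_{0,1}) ≠ 0`
for a Frobenius `φ` at a prime over a `1`-admissible `q` (split completely in `K_∞`, `φ ∈ Gal(K̄/K_∞)`), then `λ_1(q)(0) ∈ ℤ_pˣ` and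
Howard's criterion holds — the «primitive root» case of Thm. 7.5's equality; the CONTRAPOSITIVE is the reason the line `admdef`
needs a definite anchor exactly when the Heegner class vanishes modulo `p` at every admissible prime.
[cite: CastellaEtAl2025, (7.2) and Thm. 7.5 (arXiv:2308.10474v2 p0030 L57–L62, p0031 L1–L30)] [cite: Howard2006, Thm. 3.2.3 (c), §3.2 (16)]
[cite: BurungaleCastellaKim2021, arXiv:1908.09512 Prop. 7.4] -/
theorem hasUnitLambda_of_limitBaseClass_res_ne_zero (hB : IsSignedBipartiteSystem W K p κ γ N ε B)
    {z : Π n j : ℕ, (W.baseChange K).torsionH1Over ((p : ℤ) ^ j) (κ.layerSubgroup n)} (hz : B.IsLimitBaseClass z)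
    {q : ℕ} (hq : IsAdmissiblePrime N K (fun ℓ ↦ W.frobeniusTrace ℓ) p 1 q)
    {v : HeightOneSpectrum (𝓞 K)} (hv : ((q : ℕ) : 𝓞 K) ∈ v.asIdeal) {𝔓 : Ideal (absIntegers (𝓞 K) K)}
    (h𝔓 : 𝔓 ∈ v.primesAbove) {φ : absoluteGaloisGroup K} (hφ : φ ∈ κ.kerSubgroup)
    (hφD : φ ∈ 𝔓.decompositionSubgroup (absoluteGaloisGroup K)) (hφF : IsArithFrobAt (𝓞 K) φ 𝔓)
    (hne : resOfLe (geomTorsion (W.baseChange K) ((p : ℤ) ^ 1))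
      ((Subgroup.zpowers_le.mpr hφ).trans (κ.kerSubgroup_le_layerSubgroup 0)) (z 0 1) ≠ 0) :
    IsUnit (PowerSeries.constantCoeff (B.lam 1 q)) ∧ B.HasUnitLambda N := by
  rw [hz 0 1 one_pos] at hne
  exact hasUnitLambda_of_root_res_ne_zero hB hq hv h𝔓 hφ hφD hφF hne

end Root

end Summit.BirchSwinnertonDyer.BirchSwinnertonDyer.Theorems.SignedBaseChangeAcDivAdmdefUnitLambdaOfLoc

end
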